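import Mathlib
import Summits.Ventures.PercRepro2.UniversalFlow2

/-! # (UH*) on the networks whose series nodes have a child of flow ≤ 2
(seat mine-b, cell pub-perc-repro2; MINE-B.md §23)

The induction behind `SP.universal_of_flow_le_two` (UniversalFlow2.lean) uses the flow bound only at the
series nodes: a parallel node needs nothing (`universal_par`), and a series node `s ∧ t` needs one child of flow
`≤ 2` (the series lemma `SP.universal_ser_of_flow_le_two`, whose other factor is arbitrary).  So the class it
proves is larger than `flow ≤ 2`: **`SP.Good`** — every series node reached from the root through parallel nodes
has a child of flow `≤ 2`.  It contains every network of flow `≤ 2`, every bundle `B_k = e ∗ ⋯ ∗ e`, and every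
parallel composition of such networks (e.g. `B₅ ∗ (B₃ ∧ e)`, of flow 6).  The smallest network of free edges
outside it is `B₃ ∧ B₃` (six edges, flow 3) — the first open case of (UH*) on series–parallel networks. -/

namespace Summit.Ventures.PercRepro2.V2Closure

open Summit.Ventures.PercRepro2.UHClosure

/-- **the good networks**: every series node reached through parallel nodes has a child of flow `≤ 2` -/
def SP.Good : SP → Prop
  | .free => True
  | .pin => True
  | .absent => True
  | .ser s t => s.flow ≤ 2 ∨ t.flow ≤ 2
  | .par s t => s.Good ∧ t.Good

/-- a network of flow `≤ 2` is good -/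
theorem SP.good_of_flow_le_two : ∀ N : SP, N.flow ≤ 2 → N.Good
  | .free, _ => trivial
  | .pin, _ => trivial
  | .absent, _ => trivial
  | .ser s t, hf => by
      simp only [SP.flow] at hf
      show s.flow ≤ 2 ∨ t.flow ≤ 2
      omega
  | .par s t, hf => by
      simp only [SP.flow] at hf
      exact ⟨SP.good_of_flow_le_two s (by omega), SP.good_of_flow_le_two t (by omega)⟩

/-- the bundle of `n` parallel free edges (on an absent base edge) -/
def SP.bundle : ℕ → SP
  | 0 => .absent
  | n + 1 => .par (SP.bundle n) .free

/-- every bundle `e ∗ ⋯ ∗ e` (a parallel composition of free edges, any flow) is good -/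
theorem SP.good_bundle : ∀ n : ℕ, (SP.bundle n).Good
  | 0 => trivial
  | n + 1 => ⟨SP.good_bundle n, trivial⟩

/-- **(UH*) on every good network** -/
theorem SP.universal_of_good : ∀ N : SP, N.Good → Universal N.rLab N.bLab
  | .free, _ => SP.universal_free
  | .pin, _ => SP.universal_pin
  | .absent, _ => SP.universal_absent
  | .ser s t, hg => by
      rcases (hg : s.flow ≤ 2 ∨ t.flow ≤ 2) with hs | ht
      · rw [SP.rLab_comm, SP.bLab_comm]
        exact universal_transport _ _ _ (SP.universal_ser_of_flow_le_two s hs t)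
      · exact SP.universal_ser_of_flow_le_two t ht s
  | .par s t, hg =>
      universal_par s.rLab s.bLab t.rLab t.bLab (SP.universal_of_good s hg.1) (SP.universal_of_good t hg.2)

/-- (UH*) on every bundle of free edges -/
theorem SP.universal_bundle (n : ℕ) : Universal (SP.bundle n).rLab (SP.bundle n).bLab :=
  SP.universal_of_good _ (SP.good_bundle n)

end Summit.Ventures.PercRepro2.V2Closure
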